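import Mathlib
import HarnessLib
import Summits.NavierStokesRegularity.NavierStokesRegularity.Theorems.PoloidalWindowDoorLrcModEntireRadialMax

/-!
# Route `PoloidalWindowDoor`, item `LrcModEntire` (stmt-NavierStokesRegularity-20428) / crux K2 (stmt-19708) —
# level sets near a RADIALLY DECREASING centre are radial graphs (one crossing per ray)

LEAD of item 20428 ns-poloidal-K2-p3 g10 (`--supports stmt-NavierStokesRegularity-20428 --as helper`).
The Morse machinery of LINE 5 `thread_axis` (S7′-M, `…MorseLevelPackage`, K2-p2 g10) reads the leaves `{v₂(−1,·,z) = c}` near the thread as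
closed curves; its ray lemma `…MorseLevelRays.ray_crossing` assumes CONCAVITY along rays.  For the flat (quartic-nondegenerate) hot spots of the
residue S3′ concavity fails but the RADIAL hypothesis `Dg(y)(y − x₀) < 0` on a punctured ball survives (THICK-COLUMN-g10 §4(a)); this file proves
the ray package under that weaker hypothesis, in any real normed space:
* `strictAntiOn_ray_of_radial_neg` — `s ↦ g(x₀ + s u)` is strictly decreasing on `[0, r/‖u‖)`;
* `existsUnique_level_on_ray` — every level `c` with `g(x₀ + s₁u) < c < g(x₀)` is taken exactly once on `(0, s₁)`;
* `existsUnique_level_on_ray_of_hessian_neg` — the `ℝ³` specialisation under `…RadialMax`'s hypotheses (negative Hessian on a ball + critical centre).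
WHAT THIS IS NOT: not S3′, not a claim about Navier–Stokes regularity — calculus (bears_on LADDER-NS N0, rung N0-LocalTubeDoorPoloidal). [folklore]
-/

noncomputable section

-- the summit and its single sub-problem share the name (CONVENTIONS §1), as in every Theorems file
set_option linter.dupNamespace false

namespace Summit.NavierStokesRegularity.NavierStokesRegularity.Theorems.PoloidalWindowDoorLrcModEntireRadialLevels

open Set Filter Topology Metric
open Summit.NavierStokesRegularity.NavierStokesRegularity.Theorems.PoloidalWindowDoorLrcModEntireRadialMax

section General

variable {E : Type*} [NormedAddCommGroup E] [NormedSpace ℝ E]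

/-- **Radially decreasing ⇒ strictly decreasing along rays.**  If `g` is differentiable on `B(x₀,r)` with `Dg(y)(y − x₀) < 0` for
`y ≠ x₀` there, then for `u ≠ 0` the ray function `s ↦ g(x₀ + s u)` is strictly decreasing on `[0, r/‖u‖)`. [folklore] -/
theorem strictAntiOn_ray_of_radial_neg {g : E → ℝ} {x₀ : E} {r : ℝ}
    (hd : ∀ y ∈ ball x₀ r, DifferentiableAt ℝ g y) (hrad : ∀ y ∈ ball x₀ r, y ≠ x₀ → fderiv ℝ g y (y - x₀) < 0)
    {u : E} (hu : u ≠ 0) :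
    StrictAntiOn (fun s : ℝ => g (x₀ + s • u)) (Ico 0 (r / ‖u‖)) := by
  have hun : 0 < ‖u‖ := norm_pos_iff.2 hu
  have hmem : ∀ s : ℝ, 0 ≤ s → s < r / ‖u‖ → x₀ + s • u ∈ ball x₀ r := by
    intro s hs0 hs
    rw [mem_ball, dist_eq_norm, add_sub_cancel_left, norm_smul, Real.norm_eq_abs, abs_of_nonneg hs0]
    exact (lt_div_iff₀ hun).1 hs
  have hline : ∀ s : ℝ, HasDerivAt (fun s : ℝ => x₀ + s • u) u s := fun s => by
    simpa using ((hasDerivAt_id s).smul_const u).const_add x₀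
  have hderiv : ∀ s : ℝ, 0 ≤ s → s < r / ‖u‖ →
      HasDerivAt (fun s : ℝ => g (x₀ + s • u)) (fderiv ℝ g (x₀ + s • u) u) s := fun s hs0 hs =>
    (hd _ (hmem s hs0 hs)).hasFDerivAt.comp_hasDerivAt s (hline s)
  refine strictAntiOn_of_deriv_neg (convex_Ico _ _) ?_ ?_
  · intro s hs
    exact (hderiv s hs.1 hs.2).continuousAt.continuousWithinAt
  · intro s hs
    rw [interior_Ico] at hs
    rw [(hderiv s hs.1.le hs.2).deriv]
    have hy : x₀ + s • u ≠ x₀ := by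
      intro h
      have : s • u = 0 := by simpa using h
      rcases smul_eq_zero.1 this with h0 | h0
      · exact absurd h0 hs.1.ne'
      · exact hu h0
    have h := hrad _ (hmem s hs.1.le hs.2) hy
    rw [add_sub_cancel_left, map_smul, smul_eq_mul] at h
    exact (mul_neg_iff.1 h).resolve_right (fun h' => absurd hs.1 (not_lt.2 h'.1.le)) |>.2

/-- **One crossing per ray.**  Under the radial hypothesis, if `0 < s₁ < r/‖u‖` and `g(x₀ + s₁u) < c < g(x₀)`, the level `c` is taken at
exactly one parameter `s ∈ (0, s₁)` on the ray. [folklore] -/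
theorem existsUnique_level_on_ray {g : E → ℝ} {x₀ : E} {r : ℝ}
    (hd : ∀ y ∈ ball x₀ r, DifferentiableAt ℝ g y) (hrad : ∀ y ∈ ball x₀ r, y ≠ x₀ → fderiv ℝ g y (y - x₀) < 0)
    {u : E} (hu : u ≠ 0) {s₁ c : ℝ} (hs₁ : 0 < s₁) (hs₁r : s₁ < r / ‖u‖) (hc₁ : g (x₀ + s₁ • u) < c) (hc₀ : c < g x₀) :
    ∃! s : ℝ, s ∈ Ioo 0 s₁ ∧ g (x₀ + s • u) = c := by
  have hanti := strictAntiOn_ray_of_radial_neg hd hrad hu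
  set φ : ℝ → ℝ := fun s => g (x₀ + s • u) with hφ
  have hsub : Icc 0 s₁ ⊆ Ico 0 (r / ‖u‖) := fun s hs => ⟨hs.1, hs.2.trans_lt hs₁r⟩
  -- continuity on `[0, s₁]` from differentiability on the ball
  have hun : 0 < ‖u‖ := norm_pos_iff.2 hu
  have hcont : ContinuousOn φ (Icc 0 s₁) := by
    intro s hs
    have hmem : x₀ + s • u ∈ ball x₀ r := by
      rw [mem_ball, dist_eq_norm, add_sub_cancel_left, norm_smul, Real.norm_eq_abs, abs_of_nonneg hs.1]
      exact (lt_div_iff₀ hun).1 (hs.2.trans_lt hs₁r)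
    have hline : HasDerivAt (fun s : ℝ => x₀ + s • u) u s := by
      simpa using ((hasDerivAt_id s).smul_const u).const_add x₀
    exact ((hd _ hmem).hasFDerivAt.comp_hasDerivAt s hline).continuousAt.continuousWithinAt
  -- existence by the intermediate value theorem
  have hφ0 : φ 0 = g x₀ := by simp [hφ]
  obtain ⟨s, hs, hsc⟩ : c ∈ φ '' Icc 0 s₁ :=
    intermediate_value_Icc' hs₁.le hcont ⟨hc₁.le, by rw [hφ0]; exact hc₀.le⟩
  have hs0 : s ≠ 0 := by rintro rfl; rw [hφ0] at hsc; exact absurd hsc hc₀.ne'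
  have hs1 : s ≠ s₁ := by rintro rfl; exact absurd hsc hc₁.ne
  refine ⟨s, ⟨⟨lt_of_le_of_ne hs.1 (Ne.symm hs0), lt_of_le_of_ne hs.2 hs1⟩, hsc⟩, ?_⟩
  -- uniqueness by strict monotonicity
  rintro s' ⟨hs', hs'c⟩
  have h1 : s' ∈ Ico 0 (r / ‖u‖) := hsub ⟨hs'.1.le, hs'.2.le⟩
  have h2 : s ∈ Ico 0 (r / ‖u‖) := hsub hs
  exact hanti.injOn h1 h2 (hs'c.trans hsc.symm)

end General

/-- **The `ℝ³` specialisation under `…RadialMax`'s hypotheses**: `g ∈ C²`, critical centre, negative Hessian on `B(x₀,r)` ⇒ one crossing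
per ray for every level between the ray's end value and the centre value. [folklore] -/
theorem existsUnique_level_on_ray_of_hessian_neg {g : EuclideanSpace ℝ (Fin 3) → ℝ} (hg : ContDiff ℝ 2 g)
    {x₀ : EuclideanSpace ℝ (Fin 3)} {r : ℝ} (h0 : fderiv ℝ g x₀ = 0)
    (hH : ∀ y ∈ ball x₀ r, ∀ w : EuclideanSpace ℝ (Fin 3), w ≠ 0 → iteratedFDeriv ℝ 2 g y ![w, w] < 0)
    {u : EuclideanSpace ℝ (Fin 3)} (hu : u ≠ 0) {s₁ c : ℝ} (hs₁ : 0 < s₁) (hs₁r : s₁ < r / ‖u‖)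
    (hc₁ : g (x₀ + s₁ • u) < c) (hc₀ : c < g x₀) :
    ∃! s : ℝ, s ∈ Ioo 0 s₁ ∧ g (x₀ + s • u) = c :=
  existsUnique_level_on_ray (fun y _ => (hg.differentiable (by norm_num)) y)
    (fun y hy hne => fderiv_apply_self_neg_of_hessian_neg hg h0 hH hy hne) hu hs₁ hs₁r hc₁ hc₀

end Summit.NavierStokesRegularity.NavierStokesRegularity.Theorems.PoloidalWindowDoorLrcModEntireRadialLevels
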